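import Literature.MeasureTheory.Group.InvariantQuotientOrbitalTransport   -- ★ `cosetCongr`, `exists_eq_smul_map_cosetCongr_centralizer`, `descConj`, `centralizer_comm`, `continuous_descConj`
import HarnessLib

/-!
# Transport of orbit sub-level-set masses along an isomorphism and a conjugation, between ANY invariant Radon measures
# (Folland 1995 §2.6 Thm. 2.49; Beuzart-Plessis 2020 §1.8: orbit volume estimates depend on the class only)

Topic `MeasureTheory/Group`; namespace `Literature.MeasureTheory.Group`; THEOREMS ONLY (no `def`, no instance, no notation, no axiom, no named fact, no `sorry`).
Cell `pub/hodgecm-mathlib`, crux H413 (`stmt-HodgeConjecture-24833`), F0∕P3c lines LH2∕LH3 ((VOL)∕(CONV) kit); seat LH3-p03 (g2), deal «(TOT-G)» of LH2-plan (g0)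
2026-09-02T04:40:29Z — the generic §1 of the `G_∞`-side (CONV) certificate, of which ★ `ArchHyperbolicOrbitMeasureTransport` (LH2-p04, p848971) is the `2 × 2` split instance.

THE MATHEMATICS.  Let `e : G₀ ≃* G` be a bicontinuous isomorphism of topological groups (`G₀` locally compact, second countable, Hausdorff), `γ ∈ G`, `γ₀ ∈ G₀` with
`e γ₀ = h γ h⁻¹`, and `F : G → ℝ` continuous (a «radius»).  For a NON-ZERO `G`-invariant Radon measure `μ` on `G ⧸ Z(γ)` and ANY `G₀`-invariant Radon measure `μ₀` on
`G₀ ⧸ Z(γ₀)` there is one constant `c ≥ 0` with `μ₀ {x̄ ∣ F(e(x γ₀ x⁻¹)) ≤ R} = c · μ {ȳ ∣ F(y γ y⁻¹) ≤ R}` for every `R`: along `f := e⁻¹ ∘ conj(h) : G ≃* G₀`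
(`f γ = γ₀`) uniqueness of invariant measures gives `μ₀ = c • (cosetCongr f)_* μ` (★ `exists_eq_smul_map_cosetCongr_centralizer`), and the pulled-back sub-level set is
the `h`-translate of the model one (`e(f(g) γ₀ f(g)⁻¹) = (hg) γ (hg)⁻¹`), of the same `μ`-mass by invariance.  Hence every bound `μ {…} ≤ C R^a` (`R ≥ 1`) at ONE
representative and ONE invariant measure transports to every conjugate, every bicontinuously isomorphic carrier and every invariant Radon measure — the shape in which
the per-place token `hplace` of the (CONV) assemblers (★ p848924 `…ConvergenceTotal`, ★ p849184 `…ConvergenceTotalUnitary`) is discharged from estimates proved at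
normal-form representatives. [Folland1995, §2.6 Thm. 2.49; BeuzartPlessis2020Asterisque, §1.8 p. 39, §1.2 (1.2.2), (1.2.4) p. 21.]

* `exists_measure_setOf_descConj_comp_eq_mul_of_conj` — the equality `μ₀ {…} = c · μ {…}` for all `R`;
* `exists_measure_setOf_descConj_comp_le_rpow_of_conj` — the corollary in the `C R^a` (`R ≥ 1`) shape of `hplace`.
HONEST LABEL: HC_CM is proved only modulo the 7 printed citations (2 remaining: hLiu418 = `stmt-HodgeConjecture-24832`, h413 = `stmt-HodgeConjecture-24833`) until rung 0
closes; (VOL)∕(CONV) plumbing, count-neutral (+0∕+0); it pays no organ; books unchanged.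

## References
* [Folland1995] G. B. Folland, *A Course in Abstract Harmonic Analysis* (1995), §2.6 Thm. 2.49 (uniqueness of invariant measures on `G ⧸ H`).
* [BeuzartPlessis2020Asterisque] R. Beuzart-Plessis, *A local trace formula for the Gan–Gross–Prasad conjecture for unitary groups: the archimedean case*,
  Astérisque 418 (2020), §1.8 p. 39; §1.2 (1.2.2), (1.2.4) p. 21.
-/

set_option autoImplicit false

noncomputable section

open MeasureTheory MeasureTheory.Measure Set
open scoped ENNReal NNReal

/-! ## §1 Generic transport of orbit sub-level-set masses along an isomorphism and a conjugation -/

namespace Literature.MeasureTheory.Group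

section Transport

variable {G₀ G : Type*} [Group G₀] [TopologicalSpace G₀] [IsTopologicalGroup G₀] [LocallyCompactSpace G₀] [SecondCountableTopology G₀] [T2Space G₀]
  [Group G] [TopologicalSpace G] [IsTopologicalGroup G]

/-- **TRANSPORT OF ORBIT SUB-LEVEL-SET MASSES** along a bicontinuous isomorphism `e : G₀ ≃* G` and a conjugation `e γ₀ = h γ h⁻¹`: for every continuous radius
`F : G → ℝ`, every NON-ZERO `G`-invariant Radon measure `μ` on `G ⧸ Z(γ)` and every `G₀`-invariant Radon measure `μ₀` on `G₀ ⧸ Z(γ₀)` there is ONE constant `c ≥ 0` with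
`μ₀ {x̄ ∣ F(e(x γ₀ x⁻¹)) ≤ R} = c · μ {ȳ ∣ F(y γ y⁻¹) ≤ R}` for all `R` (uniqueness of invariant measures on `G₀ ⧸ Z(γ₀)` along `f = e⁻¹ ∘ conj(h)`, ★
`exists_eq_smul_map_cosetCongr_centralizer`; the pulled-back set is the `h`-translate of the model set, of the same `μ`-mass by invariance).
[cite: Folland1995, §2.6 Thm. 2.49] [cite: BeuzartPlessis2020Asterisque, §1.8 p. 39] -/
theorem exists_measure_setOf_descConj_comp_eq_mul_of_conj
    (e : G₀ ≃* G) (he : Continuous e) (hes : Continuous e.symm)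
    {γ : G} {γ₀ : G₀} (h : G) (hconj : e γ₀ = h * γ * h⁻¹) (F : G → ℝ) (hF : Continuous F)
    [MeasurableSpace (G ⧸ Subgroup.centralizer ({γ} : Set G))] [BorelSpace (G ⧸ Subgroup.centralizer ({γ} : Set G))]
    (μ : Measure (G ⧸ Subgroup.centralizer ({γ} : Set G))) [SMulInvariantMeasure G (G ⧸ Subgroup.centralizer ({γ} : Set G)) μ] [IsFiniteMeasureOnCompacts μ]
    (hμ : μ ≠ 0)
    [MeasurableSpace (G₀ ⧸ Subgroup.centralizer ({γ₀} : Set G₀))] [BorelSpace (G₀ ⧸ Subgroup.centralizer ({γ₀} : Set G₀))]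
    (μ₀ : Measure (G₀ ⧸ Subgroup.centralizer ({γ₀} : Set G₀))) [SMulInvariantMeasure G₀ (G₀ ⧸ Subgroup.centralizer ({γ₀} : Set G₀)) μ₀] [IsFiniteMeasureOnCompacts μ₀] :
    ∃ c : ℝ≥0, ∀ R : ℝ,
      μ₀ {x | descConj γ₀ (Subgroup.centralizer ({γ₀} : Set G₀)) (centralizer_comm γ₀) (F ∘ e) x ≤ R} =
        (c : ℝ≥0∞) * μ {x | descConj γ (Subgroup.centralizer ({γ} : Set G)) (centralizer_comm γ) F x ≤ R} := by
  classical
  by_cases hμ₀ : μ₀ = 0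
  · exact ⟨0, fun R => by rw [hμ₀, Measure.coe_zero, Pi.zero_apply, ENNReal.coe_zero, zero_mul]⟩
  -- the isomorphism `f = e⁻¹ ∘ conj(h) : G ≃* G₀`, `f γ = γ₀`
  set f : G ≃* G₀ := (MulAut.conj h).trans e.symm with hf
  have hef : ∀ u : G, e (f u) = h * u * h⁻¹ := fun u => by
    rw [hf, MulEquiv.trans_apply, MulEquiv.apply_symm_apply, MulAut.conj_apply]
  have hfγ : f γ = γ₀ := e.injective (by rw [hef, hconj])
  have hfc : Continuous f := hes.comp ((continuous_const.mul continuous_id).mul continuous_const)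
  have hfsymm : ∀ y : G₀, f.symm y = h⁻¹ * e y * h := fun y => by
    apply f.injective
    rw [MulEquiv.apply_symm_apply]
    apply e.injective
    rw [hef]
    group
  have hfs : Continuous f.symm := (continuous_congr hfsymm).2 ((continuous_const.mul he).mul continuous_const)
  obtain ⟨c, -, hμ₀eq⟩ := exists_eq_smul_map_cosetCongr_centralizer f hfc hfs hfγ μ μ₀ hμ hμ₀
  refine ⟨c, fun R => ?_⟩
  set E₀ : Set (G₀ ⧸ Subgroup.centralizer ({γ₀} : Set G₀)) :=
    {x | descConj γ₀ (Subgroup.centralizer ({γ₀} : Set G₀)) (centralizer_comm γ₀) (F ∘ e) x ≤ R} with hE₀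
  set E : Set (G ⧸ Subgroup.centralizer ({γ} : Set G)) :=
    {x | descConj γ (Subgroup.centralizer ({γ} : Set G)) (centralizer_comm γ) F x ≤ R} with hE
  have hE₀m : MeasurableSet E₀ :=
    measurableSet_le (continuous_descConj _ _ _ (hF.comp he)).measurable measurable_const
  have hEm : MeasurableSet E := measurableSet_le (continuous_descConj _ _ _ hF).measurable measurable_const
  -- the pulled-back set is the `h`-translate of `E`
  have hpre : cosetCongr f _ _ (forall_apply_mem_centralizer_singleton_iff_of_eq f hfγ) ⁻¹' E₀ =
      (fun x : G ⧸ Subgroup.centralizer ({γ} : Set G) => h • x) ⁻¹' E := by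
    ext x
    induction x using QuotientGroup.induction_on with
    | H g =>
      simp only [Set.mem_preimage, hE₀, hE, Set.mem_setOf_eq, cosetCongr_mk, descConj_mk, MulAction.Quotient.smul_mk, smul_eq_mul,
        Function.comp_apply]
      have key : e (f g * γ₀ * (f g)⁻¹) = h * g * γ * (h * g)⁻¹ := by
        rw [map_mul, map_mul, map_inv, hef, hconj]
        group
      rw [key]
  have hmeas : Measurable (cosetCongr f _ _ (forall_apply_mem_centralizer_singleton_iff_of_eq f hfγ)) :=
    (continuous_cosetCongr f _ _ _ hfc).measurable
  calc μ₀ E₀ = (c : ℝ≥0∞) * μ (cosetCongr f _ _ (forall_apply_mem_centralizer_singleton_iff_of_eq f hfγ) ⁻¹' E₀) := by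
        rw [hμ₀eq, Measure.smul_apply, Measure.map_apply hmeas hE₀m, ENNReal.smul_def, smul_eq_mul]
    _ = (c : ℝ≥0∞) * μ ((fun x : G ⧸ Subgroup.centralizer ({γ} : Set G) => h • x) ⁻¹' E) := by rw [hpre]
    _ = (c : ℝ≥0∞) * μ E := by rw [SMulInvariantMeasure.measure_preimage_smul (μ := μ) h hEm]

/-- **The same in the shape of the per-place token `hplace`** of the (CONV) assemblers (★ p848924 ∕ ★ p849184): a bound `μ {ȳ ∣ F(y γ y⁻¹) ≤ R} ≤ C R^a` (`R ≥ 1`) for ONE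
non-zero invariant Radon `μ` on `G ⧸ Z(γ)` transports to `μ₀ {x̄ ∣ F(e(x γ₀ x⁻¹)) ≤ R} ≤ C′ R^a` for EVERY invariant Radon `μ₀` on `G₀ ⧸ Z(γ₀)`, `e γ₀ = h γ h⁻¹`.
[cite: Folland1995, §2.6 Thm. 2.49] [cite: BeuzartPlessis2020Asterisque, §1.8 p. 39; §1.2 (1.2.2), (1.2.4) p. 21] -/
theorem exists_measure_setOf_descConj_comp_le_rpow_of_conj
    (e : G₀ ≃* G) (he : Continuous e) (hes : Continuous e.symm)
    {γ : G} {γ₀ : G₀} (h : G) (hconj : e γ₀ = h * γ * h⁻¹) (F : G → ℝ) (hF : Continuous F)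
    [MeasurableSpace (G ⧸ Subgroup.centralizer ({γ} : Set G))] [BorelSpace (G ⧸ Subgroup.centralizer ({γ} : Set G))]
    (μ : Measure (G ⧸ Subgroup.centralizer ({γ} : Set G))) [SMulInvariantMeasure G (G ⧸ Subgroup.centralizer ({γ} : Set G)) μ] [IsFiniteMeasureOnCompacts μ]
    (hμ : μ ≠ 0)
    [MeasurableSpace (G₀ ⧸ Subgroup.centralizer ({γ₀} : Set G₀))] [BorelSpace (G₀ ⧸ Subgroup.centralizer ({γ₀} : Set G₀))]
    (μ₀ : Measure (G₀ ⧸ Subgroup.centralizer ({γ₀} : Set G₀))) [SMulInvariantMeasure G₀ (G₀ ⧸ Subgroup.centralizer ({γ₀} : Set G₀)) μ₀] [IsFiniteMeasureOnCompacts μ₀]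
    {a : ℝ} (hB : ∃ C : ℝ, ∀ R : ℝ, 1 ≤ R →
      μ {x | descConj γ (Subgroup.centralizer ({γ} : Set G)) (centralizer_comm γ) F x ≤ R} ≤ ENNReal.ofReal (C * R ^ a)) :
    ∃ C : ℝ, ∀ R : ℝ, 1 ≤ R →
      μ₀ {x | descConj γ₀ (Subgroup.centralizer ({γ₀} : Set G₀)) (centralizer_comm γ₀) (F ∘ e) x ≤ R} ≤ ENNReal.ofReal (C * R ^ a) := by
  obtain ⟨c, hc⟩ := exists_measure_setOf_descConj_comp_eq_mul_of_conj e he hes h hconj F hF μ hμ μ₀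
  obtain ⟨C, hC⟩ := hB
  refine ⟨(c : ℝ) * C, fun R hR => ?_⟩
  rw [hc R, mul_assoc, ENNReal.ofReal_mul (NNReal.coe_nonneg c), ENNReal.ofReal_coe_nnreal]
  gcongr
  exact hC R hR

end Transport

end Literature.MeasureTheory.Group

end
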